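import Summits.Langlands.Langlands.Theorems.RamifiedCoefficientSeedAdjointLiftingGL3BirthDefs3
import Summits.Langlands.Langlands.Theorems.RamifiedCoefficientSeedAdjointLiftingGL3StubGaloisSeedResidual
import Literature.NumberTheory.EllipticCurves.NewformGaloisRep
import Literature.NumberTheory.GaloisRepresentations.ResidualGaloisRepOpenKernel
import HarnessLib

/-!
# Crux `AdjointLiftingGL3` (stmt-Langlands-16779), line `birth`, stub S6 (`stub_galoisSeed`):
# the residual Frobenius dictionary along an aligned coefficient map

Step (7a) of the Galois-seed stub.  Let `g ∈ S_k(Γ₁(M))`, `ι : ℚ̄_p ≃ ℂ`, and let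
`ρ_g : Γ_ℚ → GL₂(ℚ̄_p)` be attached to `g` along `ι⁻¹ : K_g ⊆ ℂ → ℚ̄_p` away from a finite set `S`
of primes (`IsGaloisRepOfNewform1`), `σ̄ : Γ_ℚ → GL₂(ℤ̄_p/𝔪)` attached to `g` along
`ι_g : 𝓞_g → ℤ̄_p/𝔪` away from `S` (`IsGaloisRepOfNewform1Int`), where `ι_g` is ALIGNED with `ι`:
`ι_g(x) = ι⁻¹(x) mod 𝔪` (the clause of `WeightTwoNewformAlong`).  Then every residual
representation `τ_g` of `ρ_g` has the characteristic polynomials of `σ̄`: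
`det(X − τ_g(σ)) = det(X − σ̄(σ))` for all `σ ∈ Γ_ℚ` (`charpoly_residual_eq_of_aligned`) — at the
Frobenius elements above `q ∉ S` both are the reduction of `ι⁻¹(X² − a_q X + ε(q) q^{k−1})`, and two
open-kernel representations with the same Frobenius polynomials almost everywhere have the same
characteristic polynomials (landed `charpoly_eq_of_frobenius_of_isOpen_ker`, Chebotarev).
-/

set_option linter.dupNamespace false -- `Summit.Langlands.Langlands` is the mandated namespace

noncomputable section

namespace Summit.Langlands.Langlands.Cruxes.AdjointLiftingGL3.Birth

open scoped MatrixGroups NumberField Polynomial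
open NumberField IsDedekindDomain Field Filter Polynomial IsLocalRing
open Literature.NumberTheory.GaloisRepresentations Literature.NumberTheory.PAdicHodge
open Literature.NumberTheory.Automorphic
open Literature.NumberTheory.EllipticCurves.ModularForms CongruenceSubgroup Rat.HeightOneSpectrum

/-- The finite places of `ℚ` over a finite set of primes form a finite set (`v ↦ p_v` is a
bijection onto the primes, Mathlib `Rat.HeightOneSpectrum.primesEquiv`). [folklore] -/
theorem eventually_primesEquiv_not_mem {S : Set ℕ} (hS : S.Finite) :
    ∀ᶠ v : HeightOneSpectrum (𝓞 ℚ) in cofinite, ((primesEquiv v : Nat.Primes) : ℕ) ∉ S := by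
  have hfin : {n : Nat.Primes | (n : ℕ) ∈ S}.Finite := hS.preimage Nat.Primes.coe_nat_injective.injOn
  have h2 : {v : HeightOneSpectrum (𝓞 ℚ) | ((primesEquiv v : Nat.Primes) : ℕ) ∈ S}.Finite := by
    change (primesEquiv ⁻¹' {n : Nat.Primes | (n : ℕ) ∈ S}).Finite
    exact hfin.preimage primesEquiv.injective.injOn
  exact eventually_cofinite.2 (h2.subset fun v hv => not_not.mp hv)

/-- A continuous homomorphism into `GL_n` of a discrete field has open kernel. [folklore] -/
theorem isOpen_ker_of_discreteTopology {k : Type*} [Field k] [TopologicalSpace k] [DiscreteTopology k]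
    {n : ℕ} (σ : FramedGaloisRep ℚ k n) :
    IsOpen ((σ.toMonoidHom).ker : Set (absoluteGaloisGroup ℚ)) := by
  have h : ((σ.toMonoidHom).ker : Set (absoluteGaloisGroup ℚ)) = σ ⁻¹' {1} := by
    ext τ
    simp [MonoidHom.mem_ker]
  rw [h]
  exact (isOpen_discrete _).preimage σ.continuous

/-- **The residual Frobenius dictionary along an aligned coefficient map.**  Let
`g ∈ S_k(Γ₁(M))`, `ι : ℚ̄_p ≃+* ℂ`, `S` a finite set of primes; let `σ̄ : Γ_ℚ → GL₂(ℤ̄_p/𝔪)`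
(continuous for the discrete topology) be attached to `g` along `ι_g : 𝓞_g → ℤ̄_p/𝔪` away from `S`
(`IsGaloisRepOfNewform1Int`) and `ρ_g : Γ_ℚ → GL₂(ℚ̄_p)` attached to `g` along `ι⁻¹|_{K_g}` away
from `S` (`IsGaloisRepOfNewform1`), and suppose `ι_g(x) = ι⁻¹(x) mod 𝔪` for all `x ∈ 𝓞_g`.  Then
every residual representation `τ_g` of `ρ_g` satisfies `det(X − τ_g(σ)) = det(X − σ̄(σ))` for ALL
`σ ∈ Γ_ℚ`: above `q ∉ S`, `det(X − ρ_g(Frob_q)) = ι⁻¹(P_q)` for the integral Hecke polynomial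
`P_q ∈ 𝓞_g[X]`, whose reduction is `ι_g(P_q) = det(X − σ̄(Frob_q))` by the alignment, while
`det(X − τ_g(Frob_q))` is that reduction (`IsResidualRepOf.hasResidualCharpolys`); conclude by
Chebotarev for open-kernel representations (`charpoly_eq_of_frobenius_of_isOpen_ker`).
[cite: DeligneSerre1974, §6] [cite: DarmonDiamondTaylor1995, §2.1, Prop. 2.6 (b)] -/
theorem charpoly_residual_eq_of_aligned :
    ∀ {p : ℕ} [Fact p.Prime] [TopologicalSpace (padicAlgClResidueField p)]
      [DiscreteTopology (padicAlgClResidueField p)] {M : ℕ} [NeZero M] {k : ℤ}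
      (g : CuspForm (Gamma1 M) k) (ι : PadicAlgCl p ≃+* ℂ)
      (ιg : coeffCharIntegers g →+* padicAlgClResidueField p) (S : Set ℕ), S.Finite →
      ∀ (σb : ModPGaloisRep ℚ (padicAlgClResidueField p) 2) (ρg : FramedGaloisRep ℚ (PadicAlgCl p) 2)
        (τg : absoluteGaloisGroup ℚ →* GL (Fin 2) (padicAlgClResidueField p)),
        IsGaloisRepOfNewform1Int g ιg S σb →
        IsGaloisRepOfNewform1 g
          ((ι.symm : ℂ →+* PadicAlgCl p).comp (algebraMap (coeffCharField g) ℂ)) S ρg →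
        (∀ x : coeffCharIntegers g,
          ∃ hx : ι.symm ((x : coeffCharField g) : ℂ) ∈ padicAlgClIntegers p,
            ιg x = residue (padicAlgClIntegers p) ⟨ι.symm ((x : coeffCharField g) : ℂ), hx⟩) →
        ρg.IsResidualRepOf (RingHom.id _) τg →
        ∀ σ : absoluteGaloisGroup ℚ,
          ((τg σ : GL (Fin 2) (padicAlgClResidueField p)) :
              Matrix (Fin 2) (Fin 2) (padicAlgClResidueField p)).charpoly =
            ((σb σ : GL (Fin 2) (padicAlgClResidueField p)) :
              Matrix (Fin 2) (Fin 2) (padicAlgClResidueField p)).charpoly := by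
  intro p _ _ _ M _ k g ι ιg S hS σb ρg τg hgal hρg hal hτg
  classical
  -- the integral coefficient map `j₀ : 𝓞_g → ℤ̄_p` under `j = ι⁻¹|_{K_g}`
  set j : coeffCharField g →+* PadicAlgCl p :=
    (ι.symm : ℂ →+* PadicAlgCl p).comp (algebraMap (coeffCharField g) ℂ) with hjdef
  have hjint : ∀ x : coeffCharIntegers g,
      (j.comp (algebraMap (coeffCharIntegers g) (coeffCharField g))) x ∈ padicAlgClIntegers p :=
    fun x => (hal x).fst
  set j₀ : coeffCharIntegers g →+* padicAlgClIntegers p :=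
    (j.comp (algebraMap (coeffCharIntegers g) (coeffCharField g))).codRestrict (padicAlgClIntegers p) hjint
    with hj₀def
  have hj₀ : (padicAlgClIntegers p).subtype.comp j₀ =
      j.comp (algebraMap (coeffCharIntegers g) (coeffCharField g)) := RingHom.ext fun x => rfl
  have hιg : ιg = (residue (padicAlgClIntegers p)).comp j₀ := RingHom.ext fun x => by
    obtain ⟨hx, e⟩ := hal x
    rw [e]
    rfl
  -- Chebotarev for the two open-kernel representations
  set σm : absoluteGaloisGroup ℚ →* GL (Fin 2) (padicAlgClResidueField p) := σb.toMonoidHom with hσmdef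
  have hσm : ∀ Φ, σm Φ = σb Φ := fun _ => rfl
  have hkσ : IsOpen (σm.ker : Set (absoluteGaloisGroup ℚ)) := isOpen_ker_of_discreteTopology σb
  have key : ∀ᶠ v : HeightOneSpectrum (𝓞 ℚ) in cofinite, ∀ 𝔓 ∈ v.primesAbove,
      ∀ Φ : absoluteGaloisGroup ℚ, IsArithFrobAt (𝓞 ℚ) Φ 𝔓 →
        ((τg Φ : GL (Fin 2) (padicAlgClResidueField p)) :
            Matrix (Fin 2) (Fin 2) (padicAlgClResidueField p)).charpoly =
          ((σm Φ : GL (Fin 2) (padicAlgClResidueField p)) :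
            Matrix (Fin 2) (Fin 2) (padicAlgClResidueField p)).charpoly := by
    filter_upwards [eventually_primesEquiv_not_mem hS] with v hv 𝔓 h𝔓 Φ hΦ
    obtain ⟨-, Pg, hPg, hσv⟩ := hgal v hv
    obtain ⟨-, hρv⟩ := hρg v hv
    obtain ⟨P, hP, hPres⟩ := hτg.hasResidualCharpolys Φ
    have h1 : ((σb Φ : GL (Fin 2) (padicAlgClResidueField p)) :
        Matrix (Fin 2) (Fin 2) (padicAlgClResidueField p)).charpoly = Pg.map ιg := hσv 𝔓 h𝔓 Φ hΦ
    have h2 : ((ρg Φ : GL (Fin 2) (PadicAlgCl p)) : Matrix (Fin 2) (Fin 2) (PadicAlgCl p)).charpoly =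
        (heckePolynomial g ((primesEquiv v : Nat.Primes) : ℕ)).map j := hρv 𝔓 h𝔓 Φ hΦ
    -- `P = j₀(P_q)`
    have h3 : P.map (padicAlgClIntegers p).subtype =
        (Pg.map j₀).map (padicAlgClIntegers p).subtype := by
      rw [Polynomial.map_map, hj₀, ← Polynomial.map_map, hPg, ← h2]
      exact hP
    have h4 : P = Pg.map j₀ :=
      Polynomial.map_injective (padicAlgClIntegers p).subtype Subtype.val_injective h3
    rw [hσm, h1, ← hPres, h4, Polynomial.map_map, RingHom.id_comp, hιg]
  intro σ
  rw [← hσm]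
  exact charpoly_eq_of_frobenius_of_isOpen_ker τg σm
    (FramedGaloisRep.isOpen_ker_of_isResidualRepOf hτg) hkσ key σ

end Summit.Langlands.Langlands.Cruxes.AdjointLiftingGL3.Birth

end
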